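import Literature.NumberTheory.GaloisCohomology.Howard2004.ConclusionCofinalTransferProofs
import Literature.NumberTheory.GaloisCohomology.Howard2004.DVRSettingPiRefinement
import HarnessLib

/-!
# Howard 2004, §1.6: the (COFINAL) letters of the `π`-adically refined tower — `hιq`, `hιk`, `hιred` for
# `S.refinedTower hy` at the marked sequence `σ k + 1 = e_k` (theorems only)

Topic `NumberTheory/GaloisCohomology/Howard2004` (junction of `ConclusionCofinalTransferProofs` —
`DVRSetting.conclusion_of_cofinal`, `DVRSetting.idxSeq_e_succ` — with the refinement constructor's first brick
`DVRSettingPiRefinement` (seat `bsd-line-x10b-p1-w2` g16: `S.piRefinementDatum hy`, `S.refinedTower hy`,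
`proj_bijective_of_eq_e`, `proj_red_eq_redIter_proj`)).  THEOREMS ONLY: no definition, no named fact, no instance,
no notation, no `sorry`.

WHY (INPUTS row G87 = `Howard2004.thm161_dvrKolyvaginBound` = Howard Thm. 1.6.1; stub `stub_h161` of the μ-crux
stmt-BirchSwinnertonDyer-22642; cell `pub/bsd-print-x9`, seat `bsd-line-x10b-p1-w7` g8, (COFINAL-J)).  The transfer
`conclusion_of_cofinal` is stated for an arbitrary cofinal embedding `(s₀, d, ι, hιq, hιk, hιred, …)`; the refined
setting of (REFINE) has tower `S.refinedTower hy` (level `i` = `T/π^{i+1}T`), and the marked levels of `S` in it are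
`σ k = e_k - 1`, i.e. `σ = idxSeq (e_0 - 1) (k ↦ e_{k+1} - e_k)` (`idxSeq_e_succ`).  This file discharges the
TOWER-SIDE letters for that embedding, cast-free, so that the assembler of `thm161` on a general `DVRSetting` only
supplies the level-condition identity at the marked levels and the bottom class:

* `host_markedSeq_le` — `host (σ k + 1) ≤ k` (so `ι k := proj : T^{(k)} → T/π^{σ k + 1}T` needs no cast);
* **`isQuotientBy_proj_markedSeq`** (`hιq`), **`ker_proj_markedSeq_eq_bot`** (`hιk`), **`proj_red_markedSeq`**
  (`hιred`: `proj (red_k y) = (S.refinedTower hy).redIter (σ k) (e_{k+1} - e_k) (proj y)`).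

HONEST FRAMING: bookkeeping; `thm161_dvrKolyvaginBound` is NOT proved (the refined `DVRSetting`, its H.0–H.5 and the
full-tower Lemma 1.6.4 are the other seats' bricks); no summit statement is proved; the Birch–Swinnerton-Dyer
conjecture is not proved by any of this.
References: [Howard2004HeegnerKolyvagin] B. Howard, Compositio Math. 140 (2004), §1.6 / Thm. 1.6.1 (arXiv:1202.6340
p. 11 L33–38, p. 12 L29–55), Def. 1.1.3 (p. 5 L93–99).
-/

set_option autoImplicit false

noncomputable section

open Function NumberField IsDedekindDomain Field
open scoped NumberField ContRepresentation

namespace Literature.NumberTheory.GaloisCohomology.Howard2004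

open Literature.NumberTheory.GaloisRepresentations
open Literature.NumberTheory.GaloisRepresentations.DiscreteGaloisModule

namespace DVRSetting

variable {p : ℕ} [Fact p.Prime] {K : Type} [Field K] [NumberField K]
  {R : Type} [CommRing R] [IsDomain R] [IsDiscreteValuationRing R] [Algebra ℤ_[p] R]
  {N : ℕ → Type} [∀ k, AddCommGroup (N k)] [∀ k, TopologicalSpace (N k)] [∀ k, DiscreteTopology (N k)]
  [∀ k, Module R (N k)]
  {Rk : ℕ → Type} [∀ k, CommRing (Rk k)] [∀ k, IsLocalRing (Rk k)] [∀ k, TopologicalSpace (Rk k)]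
  [∀ k, DiscreteTopology (Rk k)] [∀ k, Algebra ℤ_[p] (Rk k)] [∀ k, Algebra R (Rk k)]
  [∀ k, Module (Rk k) (N k)] [∀ k, IsScalarTower R (Rk k) (N k)]
  {Nbar : Type} [AddCommGroup Nbar] [TopologicalSpace Nbar] [DiscreteTopology Nbar] [∀ k, Module (Rk k) Nbar]
  {Nq : ℕ → Finset (HeightOneSpectrum (𝓞 K)) → Type} [∀ k n, AddCommGroup (Nq k n)]
  [∀ k n, TopologicalSpace (Nq k n)] [∀ k n, DiscreteTopology (Nq k n)] [∀ k n, Module (Rk k) (Nq k n)]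
  [∀ k n, Module R (Nq k n)] [∀ k n, IsScalarTower R (Rk k) (Nq k n)]

/-- The marked index `σ k + 1 = e_k` is hosted on level `k`: `host (σ k + 1) ≤ k` for the marked sequence
`σ = idxSeq (e_0 - 1) (k ↦ e_{k+1} - e_k)` — so `proj : T^{(k)} → T/π^{σ k + 1}T` is available cast-free.
[cite: Howard2004HeegnerKolyvagin, §1.6 (arXiv p. 11 L33–36, p. 12 L29–55)] -/
theorem host_markedSeq_le (S : DVRSetting p K R N Rk Nbar Nq) (hy : S.SatisfiesH) (k : ℕ) :
    (S.piRefinementDatum hy).host (idxSeq (S.e 0 - 1) (fun k => S.e (k + 1) - S.e k) k + 1) ≤ k :=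
  S.host_le_of_eq_e hy (S.idxSeq_e_succ hy k)

/-- **Letter `hιq` for the refined tower**: `proj : T^{(k)} → T/π^{σ k + 1}T` presents level `σ k` of
`S.refinedTower hy` as the quotient of `T^{(k)}` by `(π^{σ k + 1}) = (π^{e_k})`.
[cite: Howard2004HeegnerKolyvagin, Def. 1.1.3 and §1.6 (arXiv p. 5 L93–99, p. 12 L29–55)] -/
theorem isQuotientBy_proj_markedSeq (S : DVRSetting p K R N Rk Nbar Nq) (hy : S.SatisfiesH) (k : ℕ) :
    IsQuotientBy (S.T.ρ k)
      (Ideal.span {S.π ^ (idxSeq (S.e 0 - 1) (fun k => S.e (k + 1) - S.e k) k + 1)})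
      ((S.refinedTower hy).ρ (idxSeq (S.e 0 - 1) (fun k => S.e (k + 1) - S.e k) k))
      ((S.piRefinementDatum hy).proj (S.host_markedSeq_le hy k)) :=
  (S.piRefinementDatum hy).isQuotientBy_levelRep (S.host_markedSeq_le hy k)

/-- **Letter `hιk` for the refined tower**: the marked-level presentation `proj : T^{(k)} → T/π^{e_k}T` is injective.
[cite: Howard2004HeegnerKolyvagin, §1.6 (arXiv p. 11 L33–36, p. 12 L29–55)] -/
theorem ker_proj_markedSeq_eq_bot (S : DVRSetting p K R N Rk Nbar Nq) (hy : S.SatisfiesH) (k : ℕ) :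
    LinearMap.ker ((S.piRefinementDatum hy).proj (S.host_markedSeq_le hy k)) = ⊥ :=
  LinearMap.ker_eq_bot.mpr (S.proj_bijective_of_eq_e hy (S.idxSeq_e_succ hy k)).1

/-- **Letter `hιred` for the refined tower**: `proj (red_k y) = redIter (σ k) (e_{k+1} - e_k) (proj y)` between the
marked levels `σ k` and `σ (k+1) = σ k + (e_{k+1} - e_k)` of `S.refinedTower hy`.
[cite: Howard2004HeegnerKolyvagin, §1.6 (arXiv p. 12, L29–55)] -/
theorem proj_red_markedSeq (S : DVRSetting p K R N Rk Nbar Nq) (hy : S.SatisfiesH) (k : ℕ) (y : N (k + 1)) :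
    (S.piRefinementDatum hy).proj (S.host_markedSeq_le hy k) (S.T.red k y) =
      (S.refinedTower hy).redIter (idxSeq (S.e 0 - 1) (fun k => S.e (k + 1) - S.e k) k) (S.e (k + 1) - S.e k)
        ((S.piRefinementDatum hy).proj (S.host_markedSeq_le hy (k + 1)) y) :=
  S.proj_red_eq_redIter_proj hy (S.host_markedSeq_le hy k) (S.host_markedSeq_le hy (k + 1)) y

end DVRSetting

end Literature.NumberTheory.GaloisCohomology.Howard2004

end
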